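import Summits.MatrixMultiplication.MatrixMultiplication.Theorems.EisensteinValCertificatesHomocyclicSTPPDesignsUniversality

set_option linter.dupNamespace false
-- (single-conjunct summit: the namespace repeats `MatrixMultiplication`)

/-!
# Prime-cyclic universality for `HomocyclicSTPPDesigns` (crux stmt-MatrixMultiplication-10647), part 2:
# the cyclic reduction `CThesis → X′` modulo two typed lemmas (U2 glue)

Continuation of `…Universality.lean` (crux strategist gen 2, landed by the line lead c5).

* `HomocyclicSTPPDesigns_of_subs` (registered stub) — **U2 glue, PROVED composition**: `CThesis`
  (route GroupTheoreticSTPP, stmt-0593: STPP designs in arbitrary finite abelian groups beating every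
  `2+ε`, inlined) gives X′ = `HomocyclicSTPPDesigns` GIVEN two typed lemmas taken as hypotheses —
  (i) a RANK-FORM slice-rank packing bound `Σ (abc)^{2/3} ≤ ((3/4)2^{1/3})^n |K|` for every
  `K ≃ (Π_{l<n} ℤ/p^{r_l}) × G'` (rank form of BCCGNSU 2017 Thm 4.14 + §3.2, not yet in tree;
  `(3/4)2^{1/3} = e^{-δ}`, `exp_neg_bccgnsuDelta`) and (ii) a RANK PRESENTATION of every finite abelian
  `H` with `|H| > 1` (a `p`-part with `n` factors AND a Freiman presentation with the same number `n` of
  cyclic factors; structure-theorem bookkeeping).  Proof: a `CThesis` witness at `ε/67` in `H`, the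
  packing bound and the Hölder margin (`margin_of_twoThirds_bound`) give
  `Σ v^{(2+ε)/3} > e^{66δn}|H| ≥ 9^n|H| ≥ 2·3^n|H| ≥ P` for the Freiman prime `P` of the landed
  transfer `exists_prime_isSTPP_of_addEquiv` (p150288); embed `ℤ/P ↪ (Fin 1 → ℤ/P)`.
* `cThesis_iff_homocyclic_of_glue`, `noHomocyclic_iff_cAbelianObstructionNeg_of_universality` — with
  the universality arrow, `CThesis ↔ X′ (↔ AutomaticPackingThesis)` and the kill items
  `CAbelianObstructionNeg` (stmt-0596), `NoHomocyclicSTPP` (stmt-7787) coincide.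

Sources: Blasiak–Church–Cohn–Grochow–Naslund–Sawin–Umans 2017, Thm A′, Thm 4.14 and §3.2;
K. Pratt, ITCS 2024 = arXiv:2309.03878, proof of Thm 4.4 and Rem. 4.6.  Not here: the two U2 lemmas
themselves (typed only, as hypotheses of the glue).
-/

namespace Summit.MatrixMultiplication.MatrixMultiplication.Theorems.HomocyclicSTPPDesigns.Universality

open Summit.MatrixMultiplication.MatrixMultiplication.Theses.EisensteinValCertificates
  (HomocyclicSTPPDesigns NoHomocyclicSTPP)
open Summit.MatrixMultiplication.MatrixMultiplication.Theses.GroupTheoreticSTPP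
  (CThesis CAbelianObstructionNeg)
open Summit.MatrixMultiplication.MatrixMultiplication.Theses.AutomaticSTPPDesigns (AutomaticPackingThesis)
open Summit.MatrixMultiplication.MatrixMultiplication.Theorems.HomocyclicSTPPDesigns.LargeBlock
  (exists_prime_isSTPP_of_addEquiv)
open Literature.Computability.AlgebraicComplexity Literature.Combinatorics.Additive
  Literature.Barriers.MatrixMultiplication Finset
open scoped BigOperators


/-- **U2 glue (registered stub `HomocyclicSTPPDesigns_of_subs`; the strategist's PROVED composition,
re-typed).**  `CThesis` (STPP designs beating every `2+ε` in arbitrary finite abelian groups, inlined)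
implies X′ = `HomocyclicSTPPDesigns`, GIVEN (as hypotheses) a rank-form slice-rank packing bound
`Σ (abc)^{2/3} ≤ ((3/4)·2^{1/3})^n · |K|` for every `K ≃ (Π_{l<n} ℤ/p^{r_l}) × G'` (rank form of
BCCGNSU 2017 Thm 4.14 + §3.2; `(3/4)·2^{1/3} = e^{-δ}`, `exp_neg_bccgnsuDelta`) and a rank
presentation of every finite abelian `H` with `|H| > 1` (a `p`-part with `n` factors AND a Freiman
presentation with the same number `n` of cyclic factors).  Proof: take a `CThesis` witness at `ε/67`
in `H`; the packing bound and the Hölder margin (`margin_of_twoThirds_bound`) give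
`Σ v^{(2+ε)/3} > e^{66δn}|H| ≥ 9^n|H| ≥ 2·3^n|H| ≥ P` for the Freiman prime `P` of the landed
transfer `exists_prime_isSTPP_of_addEquiv`; embed `ℤ/P ↪ (Fin 1 → ℤ/P)`.
[cite: BlasiakChurchCohnGrochowNaslundSawinUmans2017, Thm. A′ and §3.2]
[cite: Pratt2024, Thm. 4.4 (proof)] -/
theorem HomocyclicSTPPDesigns_of_subs :
    (∀ ε : ℝ, 0 < ε → ∃ (H : Type) (_ : AddCommGroup H) (_ : Fintype H) (N : ℕ)
      (A B C : Fin N → Finset H), (∀ i j k : Fin N, ∀ s ∈ A k, ∀ s' ∈ A i, ∀ t ∈ B i, ∀ t' ∈ B j,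
        ∀ u ∈ C j, ∀ u' ∈ C k, (s' - s) + (t' - t) + (u' - u) = 0 →
          i = j ∧ j = k ∧ s = s' ∧ t = t' ∧ u = u') ∧
      (Fintype.card H : ℝ) < ∑ i, (((A i).card * (B i).card * (C i).card : ℕ) : ℝ) ^ ((2 + ε) / 3)) →
    (∀ (p : ℕ) [Fact p.Prime] (n : ℕ) (r : Fin n → ℕ), (∀ l, 1 ≤ r l) →
      ∀ (G' : Type) [AddCommGroup G'] [Fintype G'] [DecidableEq G'] (K : Type) [AddCommGroup K]
        [Fintype K] [DecidableEq K], Nonempty (K ≃+ ((l : Fin n) → ZMod (p ^ r l)) × G') →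
      ∀ (N : ℕ) (A B C : Fin N → Finset K), Literature.Computability.AlgebraicComplexity.IsSTPP A B C →
        ∑ i, (((A i).card * (B i).card * (C i).card : ℕ) : ℝ) ^ ((2 : ℝ) / 3) ≤
          ((3 : ℝ) / 4 * (2 : ℝ) ^ ((1 : ℝ) / 3)) ^ n * (Fintype.card K : ℝ)) →
    (∀ (H : Type) [AddCommGroup H] [Fintype H], 1 < Fintype.card H →
      ∃ (p : ℕ) (_ : Fact p.Prime) (n : ℕ) (r : Fin n → ℕ) (_ : ∀ l, 1 ≤ r l) (G' : Type)
        (_ : AddCommGroup G') (_ : Fintype G') (_ : DecidableEq G')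
        (_ : H ≃+ ((l : Fin n) → ZMod (p ^ r l)) × G') (m : Fin n → ℕ) (_ : ∀ j, 0 < m j),
        Nonempty (H ≃+ ((j : Fin n) → ZMod (m j)))) →
    HomocyclicSTPPDesigns := by
  intro hC h1 h2 ε hε
  obtain ⟨H, _i1, _i2, N, A, B, C, hS0, hlt⟩ := hC (ε / 67) (by positivity)
  classical
  have hS : IsSTPP A B C := (isSTPP_iff A B C).2 hS0
  have hHpos : (0 : ℝ) < Fintype.card H := by exact_mod_cast Fintype.card_pos
  -- `|H| > 1`
  have hH1 : 1 < Fintype.card H := by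
    by_contra hle
    push Not at hle
    haveI : Subsingleton H := Fintype.card_le_one_iff_subsingleton.1 hle
    have h := sum_rpow_le_one_of_subsingleton hS (τ := (2 + ε / 67) / 3) (by positivity)
    have h1 : (1 : ℝ) ≤ Fintype.card H := by exact_mod_cast Fintype.card_pos
    exact absurd (hlt.trans_le h) (not_lt.2 h1)
  obtain ⟨p, _ip, n, r, hr, G', _g1, _g2, _g3, e₁, m, hm, ⟨e₂⟩⟩ := h2 H hH1
  haveI : ∀ j, NeZero (m j) := fun j => ⟨(hm j).ne'⟩
  -- slice rank: `Σ v^{2/3} ≤ e^{-δ n} |H|`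
  have hF : ∑ i, (((A i).card * (B i).card * (C i).card : ℕ) : ℝ) ^ ((2 : ℝ) / 3) ≤
      Real.exp (-bccgnsuDelta * n) * Fintype.card H := by
    have h := h1 p n r hr G' H ⟨e₁⟩ N A B C hS
    have he : ((3 : ℝ) / 4 * (2 : ℝ) ^ ((1 : ℝ) / 3)) ^ n = Real.exp (-bccgnsuDelta * n) := by
      rw [← exp_neg_bccgnsuDelta, ← Real.exp_nat_mul]
      ring_nf
    rw [he] at h
    exact h
  -- Freiman
  obtain ⟨P, hP, hPle, A', B', C', hS', hcard'⟩ := exists_prime_isSTPP_of_addEquiv hS hm e₂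
  have hprod : ((∏ j, m j : ℕ) : ℝ) = Fintype.card H := by
    have h := Fintype.card_congr e₂.toEquiv
    rw [Fintype.card_pi] at h
    simp only [ZMod.card] at h
    rw [h]
  -- `n ≥ 1`
  have hn : 1 ≤ n := by
    rcases Nat.eq_zero_or_pos n with h0 | hpos
    · exfalso
      subst h0
      have h := Fintype.card_congr e₂.toEquiv
      rw [Fintype.card_pi, Finset.univ_eq_empty, Finset.prod_empty] at h
      omega
    · exact hpos
  -- the margin
  set a : Fin N → ℝ := fun i => (((A i).card * (B i).card * (C i).card : ℕ) : ℝ) with ha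
  have ha0 : ∀ i, 0 ≤ a i := fun i => Nat.cast_nonneg _
  set Y : ℝ := Real.exp (-bccgnsuDelta * n) * Fintype.card H with hY
  have hYpos : 0 < Y := by positivity
  have hmar := margin_of_twoThirds_bound Finset.univ a ha0 hHpos.le (by positivity) hF hlt
  set T : ℝ := ∑ i, a i ^ ((2 + ε) / 3) with hT
  have hE : Real.exp (-bccgnsuDelta * n) ^ 66 * Real.exp (66 * bccgnsuDelta * n) = 1 := by
    rw [← Real.exp_nat_mul, ← Real.exp_add]
    convert Real.exp_zero using 2
    push_cast
    ring
  have key : (Fintype.card H : ℝ) ^ 67 =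
      Y ^ 66 * (Real.exp (66 * bccgnsuDelta * n) * Fintype.card H) := by
    rw [hY, mul_pow, mul_mul_mul_comm, hE, one_mul, show (67 : ℕ) = 66 + 1 from rfl, pow_succ]
  rw [key] at hmar
  have h3 : Real.exp (66 * bccgnsuDelta * n) * Fintype.card H < T :=
    lt_of_mul_lt_mul_left hmar (pow_nonneg hYpos.le 66)
  -- `2 · 3^n · |H| ≤ 9^n |H| ≤ e^{66δ n} |H|`
  have h9 : (2 : ℝ) * (3 : ℝ) ^ n ≤ Real.exp (66 * bccgnsuDelta * n) := by
    have hexp : Real.exp (66 * bccgnsuDelta * n) = Real.exp (66 * bccgnsuDelta) ^ n := by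
      rw [← Real.exp_nat_mul]; congr 1; ring
    rw [hexp]
    calc (2 : ℝ) * (3 : ℝ) ^ n ≤ (3 : ℝ) ^ n * (3 : ℝ) ^ n := by
          have : (2 : ℝ) ≤ (3 : ℝ) ^ n := by
            calc (2 : ℝ) ≤ 3 := by norm_num
              _ = (3 : ℝ) ^ 1 := (pow_one _).symm
              _ ≤ (3 : ℝ) ^ n := pow_le_pow_right₀ (by norm_num) hn
          nlinarith [pow_pos (show (0:ℝ) < 3 by norm_num) n]
      _ = (9 : ℝ) ^ n := by rw [← mul_pow]; norm_num
      _ ≤ Real.exp (66 * bccgnsuDelta) ^ n :=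
          pow_le_pow_left₀ (by norm_num) nine_lt_exp_66_delta.le n
  have hPlt : (P : ℝ) < T := by
    have hPR : (P : ℝ) ≤ 2 * ((3 : ℝ) ^ n * Fintype.card H) := by
      rw [← hprod]; exact_mod_cast hPle
    calc (P : ℝ) ≤ 2 * ((3 : ℝ) ^ n * Fintype.card H) := hPR
      _ = (2 * (3 : ℝ) ^ n) * Fintype.card H := by ring
      _ ≤ Real.exp (66 * bccgnsuDelta * n) * Fintype.card H :=
          mul_le_mul_of_nonneg_right h9 hHpos.le
      _ < T := h3
  have hS'sum : ∑ i, (((A' i).card * (B' i).card * (C' i).card : ℕ) : ℝ) ^ ((2 + ε) / 3) = T := by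
    refine Finset.sum_congr rfl fun i _ => ?_
    obtain ⟨h1', h2', h3'⟩ := hcard' i
    rw [h1', h2', h3']
  -- embed `ℤ/P ↪ (Fin 1 → ℤ/P)`
  haveI : Fact P.Prime := ⟨hP⟩
  let ι₁ : ZMod P →+ (Fin 1 → ZMod P) :=
    { toFun := fun x _ => x, map_zero' := rfl, map_add' := fun _ _ => rfl }
  have hι₁inj : Function.Injective ι₁ := fun x y hxy => congrFun hxy 0
  have hS'' := hS'.image ι₁ hι₁inj
  refine ⟨P, 1, hP.isPrimePow, N, fun i => (A' i).image ι₁, fun i => (B' i).image ι₁,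
    fun i => (C' i).image ι₁, hS'', ?_⟩
  have hsum'' : ∑ i, ((((A' i).image ι₁).card * ((B' i).image ι₁).card * ((C' i).image ι₁).card : ℕ) : ℝ) ^
      ((2 + ε) / 3) = T := by
    rw [← hS'sum]
    refine Finset.sum_congr rfl fun i _ => ?_
    rw [card_image_of_injective _ hι₁inj, card_image_of_injective _ hι₁inj,
      card_image_of_injective _ hι₁inj]
  rw [hsum'', pow_one]
  exact hPlt


/-- **U2 (typed): with the two lemmas, `CThesis ↔ X′`** (the converse arrow `X′ → CThesis` is the landed
`cThesis_of_homocyclicSTPPDesigns`, p149874). -/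
theorem cThesis_iff_homocyclic_of_glue (hU : CThesis → HomocyclicSTPPDesigns) :
    CThesis ↔ HomocyclicSTPPDesigns :=
  ⟨hU, Summit.MatrixMultiplication.MatrixMultiplication.Theorems.HomocyclicSTPPDesigns.cThesis_of_homocyclicSTPPDesigns⟩

/-- Kill-side corollary of U2: under the universality arrow, `NoHomocyclicSTPP ↔ CAbelianObstructionNeg`. -/
theorem noHomocyclic_iff_cAbelianObstructionNeg_of_universality (hU : CThesis → HomocyclicSTPPDesigns) :
    NoHomocyclicSTPP ↔ CAbelianObstructionNeg := by
  constructor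
  · intro hNo
    have hnX : ¬ HomocyclicSTPPDesigns := fun hX => by
      obtain ⟨ε, hε, hall⟩ := hNo
      obtain ⟨q, ℓ, hq, N, A, B, C, hS, hlt⟩ := hX ε hε
      exact absurd (hall q ℓ hq N A B C hS) (not_le.2 hlt)
    have hnC : ¬ CThesis := fun hC => hnX (hU hC)
    unfold CThesis at hnC
    push Not at hnC
    obtain ⟨ε, hε, hall⟩ := hnC
    refine ⟨ε, hε, ?_⟩
    intro H i1 i2 N A B C hS
    exact hall H i1 i2 N A B C hS
  · rintro ⟨ε, hε, hall⟩
    refine ⟨ε, hε, fun q ℓ hq N A B C hS => ?_⟩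
    haveI : NeZero q := ⟨hq.ne_zero⟩
    have h := @hall (Fin ℓ → ZMod q) _ _ N A B C ((isSTPP_iff A B C).1 hS)
    have hcard : (Fintype.card (Fin ℓ → ZMod q) : ℝ) = (q : ℝ) ^ ℓ := by
      rw [Fintype.card_fun, ZMod.card, Fintype.card_fin]; push_cast; rfl
    rwa [hcard] at h


end Summit.MatrixMultiplication.MatrixMultiplication.Theorems.HomocyclicSTPPDesigns.Universality
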